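import Mathlib
import Summits.MatrixMultiplication.MatrixMultiplication.Theorems.GradedDesignFamily.Negative.SubfieldCellCeiling
import Literature.NumberTheory.GaloisRepresentations.SL2WreathResidualImage

/-!
# The explicit ceiling for the quadratic-extension cell: `|Y| + |Z| ≤ q³ + 2q + 2`
# (crux `LevelGradedCohnUmans.GradedDesignFamily`, stmt-MatrixMultiplication-7610; negative side,
# line `quadratic-extension-level-one-cell`, stub `subfieldCell_ceiling_explicit`)

The line's open design stub S3 (`stub_subfieldCell`) asks for finite sets `Y, Z ⊆ GL₂(K)`,
level-one separated against the image of an injective hom `φ : SL₂(k) →* GL₂(K)`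
(`|K| = q²`, `q := |k|`), of size `|Y|, |Z| ≥ c |K|^{3/2} = c q³`.  The standing ceiling
`subfieldCell_ceiling` reads `|φ(SL₂ k)|·|Z| + |φ(SL₂ k)|·(|Y| − 1) ≤ |K|³ + |K|²`.  This file
makes it explicit in `q`:

* `subfieldCell_ceiling_explicit` — `|Y| + |Z| ≤ q³ + 2q + 2`.

PROOF.  `|φ(SL₂ k)| = |SL₂(k)|` (`φ` injective) `= q (q² − 1)`
(`Literature…SL2Wreath.natCard_specialLinearGroup_fin_two`), and `|K| = q²`, so the standing
ceiling is `q (q² − 1) · S ≤ q⁶ + q⁴` with `S := |Z| + (|Y| − 1)`.  If `S ≥ q³ + 2q + 2` then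
`q (q² − 1) · S ≥ (q³ − q)(q³ + 2q + 2) = q⁶ + q⁴ + 2q³ − 2q² − 2q > q⁶ + q⁴` as `q ≥ 2`,
a contradiction; hence `S ≤ q³ + 2q + 1` and `|Y| + |Z| = S + 1 ≤ q³ + 2q + 2` (`|Y| ≥ 1`).
In particular `min(|Y|, |Z|) ≤ (q³ + 2q + 2) / 2`, i.e. the constant of S3 is capped at
`c ≤ 1/2 + o(1)`.

Sorry-free; axioms `propext`, `Classical.choice`, `Quot.sound`.
-/

set_option linter.dupNamespace false

open scoped BigOperators

namespace Summit.MatrixMultiplication.MatrixMultiplication.Theorems.GradedDesignFamily.Negative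

/-- The arithmetic of the explicit ceiling: for naturals `q ≥ 2`, `a ≥ 1`, `b`, if
`q (q² − 1) · b + q (q² − 1) · (a − 1) ≤ (q²)³ + (q²)²` then `a + b ≤ q³ + 2q + 2`. -/
private theorem ceiling_arith {q a b : ℕ} (hq : 1 < q) (ha : 0 < a)
    (h : q * (q ^ 2 - 1) * b + q * (q ^ 2 - 1) * (a - 1) ≤ (q ^ 2) ^ 3 + (q ^ 2) ^ 2) :
    a + b ≤ q ^ 3 + 2 * q + 2 := by
  have hq2 : 1 ≤ q ^ 2 := Nat.one_le_pow _ _ (by omega)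
  have ha1 : 1 ≤ a := ha
  refine Nat.le_of_not_lt fun hc => ?_
  have hc' : q ^ 3 + 2 * q + 2 + 1 ≤ a + b := Nat.lt_iff_add_one_le.mp hc
  zify [hq2, ha1] at h
  zify at hc' hq
  have hq0 : (0 : ℤ) ≤ (q : ℤ) := Int.natCast_nonneg q
  have hq2' : (0 : ℤ) ≤ (q : ℤ) - 2 := by linarith
  have hP : (0 : ℤ) ≤ (q : ℤ) * ((q : ℤ) ^ 2 - 1) := by nlinarith
  nlinarith [mul_le_mul_of_nonneg_left hc' hP, mul_nonneg (mul_nonneg hq0 hq0) hq2',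
    mul_nonneg hq0 hq2']

/-- **The explicit ceiling for the quadratic-extension cell.**  If `Y, Z ⊆ GL₂(K)` are nonempty
and level-one separated against the image of an injective hom `φ : SL₂(k) →* GL₂(K)` (S3's
separation clause, verbatim), and `|K| = |k|²`, then `|Y| + |Z| ≤ |k|³ + 2|k| + 2`: the standing
ceiling `|φ(SL₂ k)|·(|Z| + |Y| − 1) ≤ |K|³ + |K|²` with `|φ(SL₂ k)| = |SL₂(k)| = |k| (|k|² − 1)`
made explicit.  In particular S3's constant is capped at `c ≤ 1/2 + o(1)`. -/
theorem subfieldCell_ceiling_explicit {k K : Type} [Field k] [Fintype k] [DecidableEq k] [Field K]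
    [Fintype K] [DecidableEq K]
    (φ : Matrix.SpecialLinearGroup (Fin 2) k →* Matrix.GeneralLinearGroup (Fin 2) K)
    (hφ : Function.Injective φ) (hK : Fintype.card K = Fintype.card k ^ 2)
    (Y Z : Finset (Matrix.GeneralLinearGroup (Fin 2) K)) (hY : Y.Nonempty) (hZ : Z.Nonempty)
    (hsep : ∀ z₀ ∈ Z, ∃ cf : (Fin 2 → K) → (Fin 2 → K) → ℂ,
      ∀ a : Matrix.SpecialLinearGroup (Fin 2) k, ∀ y ∈ Y, ∀ y' ∈ Y, ∀ z ∈ Z,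
        (∑ u : Fin 2 → K, cf u (((φ a * y * y'⁻¹ * z : Matrix.GeneralLinearGroup (Fin 2) K) :
            Matrix (Fin 2) (Fin 2) K).mulVec u)) =
          if a = 1 ∧ y = y' ∧ z = z₀ then 1 else 0) :
    Y.card + Z.card ≤ Fintype.card k ^ 3 + 2 * Fintype.card k + 2 := by
  -- the standing ceiling `|φ(SL₂ k)|·|Z| + |φ(SL₂ k)|·(|Y| − 1) ≤ |K|³ + |K|²`
  have h := subfieldCell_ceiling φ hφ Y Z hY hZ hsep
  -- `|φ(SL₂ k)| = |SL₂(k)| = q (q² − 1)`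
  have himg : (Finset.univ.image φ).card = Fintype.card k * (Fintype.card k ^ 2 - 1) := by
    rw [Finset.card_image_of_injective _ hφ, Finset.card_univ, ← Nat.card_eq_fintype_card]
    exact Literature.NumberTheory.GaloisRepresentations.SL2Wreath.natCard_specialLinearGroup_fin_two
  -- `|K| = q²`, then the arithmetic
  rw [himg, hK] at h
  exact ceiling_arith Fintype.one_lt_card hY.card_pos h

end Summit.MatrixMultiplication.MatrixMultiplication.Theorems.GradedDesignFamily.Negative
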